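import Mathlib.FieldTheory.PrimitiveElement
import Mathlib.RingTheory.Trace.Basic
import Mathlib.LinearAlgebra.FiniteDimensional.Lemmas
import Mathlib.LinearAlgebra.BilinearForm.Properties
import Mathlib.NumberTheory.Padics.Complex
import Literature.NumberTheory.EllipticCurves.NewformPadicIntegralModel
import Literature.NumberTheory.EllipticCurves.SharpFlatPAdicLFunctionCoeffField
import HarnessLib

/-!
# Station (R) of line `onepair` (crux RSL_g, stmt-BirchSwinnertonDyer-22608) — file R1: the DEDEKIND EXPANSION of linear functionals on the
# `p`-adic coefficient field along its embeddings, the TRANSFER lemma and the RATIONALITY lemma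

Route `ResidualThetaTransportAtTwo` (RTT), crux `ResidualSignedLambdaLowerCMAtTwo` (stmt-BirchSwinnertonDyer-22608), line `onepair` v3f, station (R)
`stub_kzgValueRelation` (the value relation `C ν · e(𝒸 z) = μ̃ · (L⁻ · u)` of the KZ_g interior). Seat `bsd-wall-tp2-p2x-w3` g18 (width seat; helper file,
`--supports`, closes nothing). PURE ALGEBRA, THEOREMS ONLY (no definition, no instance, no notation, no `sorry`). BSD is not proved by anything here; 22608 / 26074 / 24105 stay OPEN / HOLD.

WHY (memo `STATION-R-PORT-w3g18.md`, evidence #54 on 22608, F2/F3): the supplier of the primitive values of `e(P⃗_{2m}(z))` for an ADMISSIBLE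
trivialisation `e` must kill the components of Kato's value vector along the NON-identity embeddings `σ : K → ℚ̄₂` of `K = ℚ₂(range ι)` — Artin–Dedekind
independence applied to `y ↦ Σ_i t₀(c′_i y) ε_i(ζ−1)`. For `K/F` finite separable and `L ⊇ F` algebraically closed (used at `ℚ_p ⊆ ℚ_p(S) ⊆ ℂ_p`):
* `exists_basis_algHom` — the embeddings `σ : K →ₐ[F] L` form an `L`-basis of `K →ₗ[F] L` (independence of characters
  `linearIndependent_algHom_toLinearMap` / `eq_zero_of_sum_mul_apply_eq_zero` + `#Emb = [K:F]`); Dedekind expansion `f = Σ_σ a_σ σ`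
  (`exists_apply_eq_sum_mul`, uniqueness `eq_of_forall_sum_mul_apply_eq`).
* TRANSFER `sum_mul_eq_coeff_mul_sum`: if `Σ_l f(y b_l) W_l = ι₀(y) · Σ_l f(b_l) W_l` for all `y` and `f = Σ_σ a_σ σ`, then
  `Σ_l f(b_l) W_l = a_{ι₀} · Σ_l ι₀(b_l) W_l`, and `a_σ · Σ_l σ(b_l) W_l = 0` for `σ ≠ ι₀` (`coeff_mul_sum_eq_zero_of_ne`).
* TRACE DUAL `existsUnique_trace_mul_eq` (`t = Tr_{K/F}(δ ·)`), `algebraMap_apply_eq_sum_of_trace_mul_eq` (the coefficients of an `F`-valued `t` are `σ(δ)`).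
* RATIONALITY `exists_forall_eq_apply_of_forall_sum_mem_range`: if `a ↦ Σ_σ σ(c) v_σ σ(a)` is `F`-valued (`c ≠ 0`), the components `v_σ` are the
  `σ`-conjugates of ONE element of `K`.
* The `p`-adic specialisation (`K = padicCoeffField S`, `𝒪 = padicCoeffIntegers S`): `exists_linearMap_extend` (ℤ_p-linear maps on `𝒪` extend
  ℚ_p-linearly to `K = 𝒪[1/p]`, uniquely: `linearMap_ext_of_padicCoeffIntegers`); station (R) applies the transfer at the inclusion
  `ι₀ := (IsScalarTower.toAlgHom ℚ_p ℚ̄_p ℂ_p).comp (padicCoeffField S).val`.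

References: [Lang2002] Ch. VI §4 Thm. 4.1 (Artin: independence of characters), Ch. VI §5 Thm. 5.2 and Cor. 5.3 (trace form non-degenerate,
dual basis); [Kato2004Asterisque] Thm. 12.5 (1) (p. 221) (where the expansion is consumed).
-/

set_option autoImplicit false
-- D-0017: single-problem summit, so `Summit.BirchSwinnertonDyer.BirchSwinnertonDyer.…` repeats a namespace BY DESIGN.
set_option linter.dupNamespace false

noncomputable section

open scoped Classical
open Module

namespace Summit.BirchSwinnertonDyer.BirchSwinnertonDyer.Theorems.ThetaTransport.StationR

/-! ## §1 Generic: embeddings of a finite separable extension as a basis of the `L`-valued functionals -/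

section Generic

variable (F K L : Type*) [Field F] [Field K] [Field L] [Algebra F K] [Algebra F L]
  [FiniteDimensional F K] [Algebra.IsSeparable F K] [IsAlgClosed L]

omit [FiniteDimensional F K] [Algebra.IsSeparable F K] [IsAlgClosed L] in
/-- **Artin–Dedekind**: the `F`-algebra embeddings `σ : K → L`, viewed as `F`-linear maps, are linearly independent over `L`.
[cite: Lang2002, Ch. VI §4 Thm. 4.1] -/
theorem linearIndependent_algHom_toLinearMap :
    LinearIndependent L (fun σ : K →ₐ[F] L => σ.toLinearMap) := by
  have h0 := linearIndependent_monoidHom K L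
  have h1 : LinearIndependent L (fun σ : K →ₐ[F] L => ((σ : K →* L) : K → L)) := by
    refine h0.comp (fun σ : K →ₐ[F] L => (σ : K →* L)) ?_
    intro σ τ h
    apply AlgHom.ext
    intro x
    exact DFunLike.congr_fun h x
  let coeL : (K →ₗ[F] L) →ₗ[L] (K → L) := { toFun := fun f => ⇑f, map_add' := fun _ _ => rfl, map_smul' := fun _ _ => rfl }
  refine LinearIndependent.of_comp coeL ?_
  convert h1 using 1
  funext σ
  rfl

omit [Algebra.IsSeparable F K] [IsAlgClosed L] in
/-- **Independence of characters, coefficient form**: `Σ_σ c_σ σ(y) = 0` for all `y` forces `c = 0`. [cite: Lang2002, Ch. VI §4 Thm. 4.1] -/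
theorem eq_zero_of_sum_mul_apply_eq_zero (c : (K →ₐ[F] L) → L) (h : ∀ y, ∑ σ : K →ₐ[F] L, c σ * σ y = 0)
    (σ : K →ₐ[F] L) : c σ = 0 := by
  have hli := linearIndependent_algHom_toLinearMap F K L
  have hsum : ∑ τ : K →ₐ[F] L, c τ • (τ.toLinearMap : K →ₗ[F] L) = 0 := by
    apply LinearMap.ext
    intro y
    simp only [LinearMap.coe_sum, Finset.sum_apply, LinearMap.smul_apply, AlgHom.toLinearMap_apply, smul_eq_mul,
      LinearMap.zero_apply, h y]
  exact Fintype.linearIndependent_iff.mp hli c hsum σ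

omit [Algebra.IsSeparable F K] [IsAlgClosed L] in
/-- `dim_L Hom_F(K, L) = [K : F]`. [cite: Lang2002, Ch. VI §5 (dual space of a finite extension)] -/
theorem finrank_linearMap_eq : finrank L (K →ₗ[F] L) = finrank F K := by
  have e := ((Module.finBasis F K).constr L : (Fin (finrank F K) → L) ≃ₗ[L] (K →ₗ[F] L))
  rw [← e.finrank_eq, Module.finrank_fin_fun]

/-- **The embedding basis exists**: `{σ : K →ₐ[F] L}` is an `L`-basis of `K →ₗ[F] L` (independence + `#Emb = [K:F]`, `L` algebraically closed).
[cite: Lang2002, Ch. VI §4 Thm. 4.1] -/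
theorem exists_basis_algHom : ∃ b : Basis (K →ₐ[F] L) L (K →ₗ[F] L), ∀ σ, b σ = σ.toLinearMap := by
  haveI : FiniteDimensional L (K →ₗ[F] L) :=
    LinearEquiv.finiteDimensional ((Module.finBasis F K).constr L : (Fin (finrank F K) → L) ≃ₗ[L] (K →ₗ[F] L))
  refine ⟨basisOfLinearIndependentOfCardEqFinrank' (fun σ : K →ₐ[F] L => σ.toLinearMap)
    (linearIndependent_algHom_toLinearMap F K L) (by rw [AlgHom.card, finrank_linearMap_eq]), fun σ => ?_⟩
  simp only [coe_basisOfLinearIndependentOfCardEqFinrank']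

/-- **Dedekind expansion (existence)**: every `F`-linear `f : K → L` is `Σ_σ a_σ σ` for some coefficient family `a`.
[cite: Lang2002, Ch. VI §4 Thm. 4.1] -/
theorem exists_apply_eq_sum_mul (f : K →ₗ[F] L) :
    ∃ a : (K →ₐ[F] L) → L, ∀ y, f y = ∑ σ : K →ₐ[F] L, a σ * σ y := by
  obtain ⟨b, hb⟩ := exists_basis_algHom F K L
  refine ⟨fun σ => b.repr f σ, fun y => ?_⟩
  have h := b.sum_repr f
  conv_lhs => rw [← h]
  simp only [LinearMap.coe_sum, Finset.sum_apply, LinearMap.smul_apply, hb, AlgHom.toLinearMap_apply, smul_eq_mul]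

variable {F K L}

omit [Algebra.IsSeparable F K] [IsAlgClosed L] in
/-- **Dedekind expansion (uniqueness)**: two coefficient families expanding the same `f` agree. [cite: Lang2002, Ch. VI §4 Thm. 4.1] -/
theorem eq_of_forall_sum_mul_apply_eq (a c : (K →ₐ[F] L) → L)
    (h : ∀ y, ∑ σ : K →ₐ[F] L, a σ * σ y = ∑ σ : K →ₐ[F] L, c σ * σ y) : a = c := by
  funext σ
  have := eq_zero_of_sum_mul_apply_eq_zero F K L (fun τ => a τ - c τ) (fun y => by
    simp only [sub_mul, Finset.sum_sub_distrib, h y, sub_self]) σ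
  exact sub_eq_zero.mp this

/-! ### The transfer lemma (finding F2 of the memo) -/

omit [Algebra.IsSeparable F K] [IsAlgClosed L] in
/-- **TRANSFER (the `σ ≠ ι₀` components die).** If an `F`-linear `f = Σ_σ a_σ σ : K → L`, a family `b_l ∈ K` and weights `W_l ∈ L` satisfy the
`ι₀`-equivariance `Σ_l f(y·b_l) W_l = ι₀(y) · Σ_l f(b_l) W_l` for every `y ∈ K`, then for every embedding `σ ≠ ι₀`: `a_σ · Σ_l σ(b_l) W_l = 0`.
(The hypothesis reads `Σ_σ a_σ w_σ (σ y − ι₀ y) = 0`, `w_σ := Σ_l σ(b_l) W_l`; independence of characters.) [cite: Lang2002, Ch. VI §4 Thm. 4.1] -/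
theorem coeff_mul_sum_eq_zero_of_ne (ι₀ : K →ₐ[F] L) (f : K →ₗ[F] L) (a : (K →ₐ[F] L) → L) (ha : ∀ y, f y = ∑ σ : K →ₐ[F] L, a σ * σ y)
    {ι : Type*} [Fintype ι] (b : ι → K) (W : ι → L)
    (h : ∀ y : K, ∑ l, f (y * b l) * W l = ι₀ y * ∑ l, f (b l) * W l) (σ : K →ₐ[F] L) (hσ : σ ≠ ι₀) :
    a σ * ∑ l, σ (b l) * W l = 0 := by
  set C : L := ∑ l, f (b l) * W l with hC
  set c : (K →ₐ[F] L) → L := fun τ => a τ * (∑ l, τ (b l) * W l) - (if τ = ι₀ then C else 0) with hc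
  have hvan : ∀ y, ∑ τ : K →ₐ[F] L, c τ * τ y = 0 := by
    intro y
    have h1 : ∑ l, f (y * b l) * W l = ∑ τ : K →ₐ[F] L, (a τ * ∑ l, τ (b l) * W l) * τ y := by
      simp_rw [ha, Finset.sum_mul, map_mul]
      rw [Finset.sum_comm]
      refine Finset.sum_congr rfl fun τ _ => ?_
      rw [Finset.mul_sum, Finset.sum_mul]
      refine Finset.sum_congr rfl fun l _ => ?_
      ring
    have h2 : ∑ τ : K →ₐ[F] L, (if τ = ι₀ then C else 0) * τ y = ι₀ y * C := by
      rw [Finset.sum_eq_single ι₀]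
      · simp [mul_comm]
      · intro τ _ hτ; simp [hτ]
      · intro hh; exact absurd (Finset.mem_univ _) hh
    simp only [hc, sub_mul, Finset.sum_sub_distrib]
    rw [← h1, h2, h y, hC, sub_self]
  have := eq_zero_of_sum_mul_apply_eq_zero F K L c hvan σ
  simpa [hc, hσ] using this

omit [Algebra.IsSeparable F K] [IsAlgClosed L] in
/-- **TRANSFER (the `ι₀` component carries everything).** Under the same `ι₀`-equivariance, `Σ_l f(b_l) W_l = a_{ι₀} · Σ_l ι₀(b_l) W_l`.
[cite: Lang2002, Ch. VI §4 Thm. 4.1] -/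
theorem sum_mul_eq_coeff_mul_sum (ι₀ : K →ₐ[F] L) (f : K →ₗ[F] L) (a : (K →ₐ[F] L) → L) (ha : ∀ y, f y = ∑ σ : K →ₐ[F] L, a σ * σ y)
    {ι : Type*} [Fintype ι] (b : ι → K) (W : ι → L)
    (h : ∀ y : K, ∑ l, f (y * b l) * W l = ι₀ y * ∑ l, f (b l) * W l) :
    ∑ l, f (b l) * W l = a ι₀ * ∑ l, ι₀ (b l) * W l := by
  have hexp : ∑ l, f (b l) * W l = ∑ τ : K →ₐ[F] L, a τ * ∑ l, τ (b l) * W l := by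
    simp_rw [ha, Finset.sum_mul]
    rw [Finset.sum_comm]
    refine Finset.sum_congr rfl fun τ _ => ?_
    rw [Finset.mul_sum]
    refine Finset.sum_congr rfl fun l _ => ?_
    ring
  rw [hexp, Finset.sum_eq_single ι₀]
  · intro τ _ hτ
    exact coeff_mul_sum_eq_zero_of_ne ι₀ f a ha b W h τ hτ
  · intro hh; exact absurd (Finset.mem_univ _) hh

/-! ### The trace dual of an `F`-valued functional and its coordinates -/

/-- **Trace dual**: every `F`-valued functional `t : K →ₗ[F] F` is `y ↦ Tr_{K/F}(δ y)` for a unique `δ ∈ K` (trace form non-degenerate).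
[cite: Lang2002, Ch. VI §5 Thm. 5.2 and Cor. 5.3] -/
theorem existsUnique_trace_mul_eq (t : K →ₗ[F] F) : ∃! δ : K, ∀ y, Algebra.trace F K (δ * y) = t y := by
  have hnd := traceForm_nondegenerate F K
  refine ⟨((Algebra.traceForm F K).toDual hnd).symm t, fun y => ?_, fun δ hδ => ?_⟩
  · rw [← Algebra.traceForm_apply]
    exact LinearMap.BilinForm.apply_toDual_symm_apply t y
  · apply ((Algebra.traceForm F K).toDual hnd).injective
    rw [LinearEquiv.apply_symm_apply]
    apply LinearMap.ext
    intro y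
    rw [LinearMap.BilinForm.toDual_def, Algebra.traceForm_apply, hδ y]

/-- **Expansion of an `F`-valued functional**: if `t = Tr(δ ·)` then `algebraMap (t y) = Σ_σ σ(δ) σ(y)` (`Tr = Σ_σ σ`), i.e. the Dedekind
coefficients of `algebraMap ∘ t` are `σ ↦ σ(δ)`. [cite: Lang2002, Ch. VI §5 Thm. 5.2] -/
theorem algebraMap_apply_eq_sum_of_trace_mul_eq (t : K →ₗ[F] F) (δ : K) (hδ : ∀ y, Algebra.trace F K (δ * y) = t y) (y : K) :
    algebraMap F L (t y) = ∑ σ : K →ₐ[F] L, σ δ * σ y := by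
  rw [← hδ y, trace_eq_sum_embeddings L (K := F) (L := K)]
  simp_rw [map_mul]

/-! ### Rationality (finding F3 of the memo): `F`-valued recombinations have CONJUGATE components -/

omit [FiniteDimensional F K] [Algebra.IsSeparable F K] [IsAlgClosed L] in
/-- An `F`-linear map `K → L` with values in `F ⊆ L` factors through `F`. [folklore: plumbing] -/
theorem exists_eq_algebraMap_comp (f : K →ₗ[F] L) (hf : ∀ y, f y ∈ Set.range (algebraMap F L)) :
    ∃ t : K →ₗ[F] F, f = (Algebra.linearMap F L).comp t := by
  have hinj : Function.Injective (Algebra.linearMap F L) := (algebraMap F L).injective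
  choose g hg using hf
  refine ⟨{ toFun := g, map_add' := ?_, map_smul' := ?_ }, ?_⟩
  · intro x y
    apply hinj
    simp only [Algebra.linearMap_apply, map_add, hg]
  · intro c x
    apply hinj
    rw [Algebra.linearMap_apply, Algebra.linearMap_apply, RingHom.id_apply, hg, LinearMap.map_smul, smul_eq_mul, map_mul,
      hg, Algebra.smul_def]
  · apply LinearMap.ext
    intro y
    simp only [LinearMap.comp_apply, Algebra.linearMap_apply, LinearMap.coe_mk, AddHom.coe_mk, hg]

/-- **RATIONALITY.** If `c ∈ K`, `c ≠ 0`, and components `v_σ ∈ L` make `a ↦ Σ_σ σ(c)·v_σ·σ(a)` an `F`-VALUED function on `K`, then the `v_σ`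
are the `σ`-conjugates of one element of `K`: `∃ b ∈ K, ∀ σ, v_σ = σ b` (Dedekind uniqueness against `Tr(β ·) = Σ_σ σ(β) σ(·)`).
[cite: Lang2002, Ch. VI §4 Thm. 4.1 and §5 Cor. 5.3] -/
theorem exists_forall_eq_apply_of_forall_sum_mem_range (c : K) (hc : c ≠ 0) (v : (K →ₐ[F] L) → L)
    (h : ∀ a : K, (∑ σ : K →ₐ[F] L, σ c * v σ * σ a) ∈ Set.range (algebraMap F L)) :
    ∃ b : K, ∀ σ : K →ₐ[F] L, v σ = σ b := by
  -- the functional `a ↦ Σ σ(c) v_σ σ(a)`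
  set f : K →ₗ[F] L := ∑ σ : K →ₐ[F] L, (σ c * v σ) • σ.toLinearMap with hfdef
  have hf : ∀ a, f a = ∑ σ : K →ₐ[F] L, (σ c * v σ) * σ a := by
    intro a
    simp only [hfdef, LinearMap.coe_sum, Finset.sum_apply, LinearMap.smul_apply, AlgHom.toLinearMap_apply, smul_eq_mul]
  obtain ⟨t, ht⟩ := exists_eq_algebraMap_comp f (fun a => by rw [hf]; exact h a)
  obtain ⟨δ, hδ, -⟩ := existsUnique_trace_mul_eq t
  refine ⟨δ / c, fun σ => ?_⟩
  -- two expansions of the same functional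
  have heq : (fun τ : K →ₐ[F] L => τ c * v τ) = fun τ => τ δ := by
    refine eq_of_forall_sum_mul_apply_eq _ _ fun y => ?_
    rw [← hf y, ← algebraMap_apply_eq_sum_of_trace_mul_eq t δ hδ y, ht, LinearMap.comp_apply, Algebra.linearMap_apply]
  have h1 : σ c * v σ = σ δ := congrFun heq σ
  have hσc : σ c ≠ 0 := by
    intro h0
    exact hc (by simpa using (σ.toRingHom.injective (h0.trans (map_zero σ).symm)))
  rw [map_div₀, ← h1, mul_div_cancel_left₀ _ hσc]

end Generic

/-! ## §2 The `p`-adic specialisation: `K = ℚ_p(S) ⊆ ℚ̄_p`, `L = ℂ_p`, `ι₀` = the inclusion -/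

section Padic

open Literature.NumberTheory.EllipticCurves

variable {p : ℕ} [Fact p.Prime] (S : Set (PadicAlgCl p))

/-- `p^a · x ∈ 𝒪` for `x ∈ ℚ_p(S)` and `a` large (`𝒪[1/p] = ℚ_p(S)`), inside the intermediate field.
[cite: EmertonPollackWeston2006, §3.1 (p. 17)] -/
theorem exists_pow_smul_mem_padicCoeffIntegers (x : padicCoeffField S) :
    ∃ a : ℕ, (((p : ℚ_[p]) ^ a • x : padicCoeffField S) : PadicAlgCl p) ∈ padicCoeffIntegers S := by
  have hp1 : (1 : ℝ) < p := by exact_mod_cast (Fact.out : p.Prime).one_lt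
  have hp0 : (0 : ℝ) < p := lt_trans zero_lt_one hp1
  obtain ⟨a, ha⟩ := pow_unbounded_of_one_lt ‖(x : PadicAlgCl p)‖ hp1
  refine ⟨a, ((p : ℚ_[p]) ^ a • x).2, ?_⟩
  rw [IntermediateField.coe_smul, Algebra.smul_def, norm_mul, map_pow, norm_pow, map_natCast]
  have hnp : ‖(p : PadicAlgCl p)‖ = (p : ℝ)⁻¹ := by
    rw [← map_natCast (algebraMap ℚ_[p] (PadicAlgCl p)) p]
    change ‖((p : ℚ_[p]) : PadicAlgCl p)‖ = _
    rw [PadicAlgCl.norm_extends, Padic.norm_p]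
  rw [hnp, inv_pow, inv_mul_le_iff₀ (pow_pos hp0 a), mul_one]
  exact ha.le

/-- The element `p^a · x` of `𝒪` (for a witness `a`). [cite: EmertonPollackWeston2006, §3.1 (p. 17) (plumbing)] -/
theorem coe_toField_mk_pow_smul (x : padicCoeffField S) (a : ℕ)
    (h : (((p : ℚ_[p]) ^ a • x : padicCoeffField S) : PadicAlgCl p) ∈ padicCoeffIntegers S) :
    padicCoeffIntegers.toField S ⟨_, h⟩ = (p : ℚ_[p]) ^ a • x := by
  apply Subtype.ext; rfl

/-- `ι₀(c) · a` read in `K`: `toField (ι₀ c * a) = c • toField a`. [cite: EmertonPollackWeston2006, §3.1 (p. 17) (plumbing)] -/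
theorem toField_padicIntToCoeffIntegers_mul (c : ℤ_[p]) (a : padicCoeffIntegers S) :
    padicCoeffIntegers.toField S (padicIntToCoeffIntegers S c * a) = (c : ℚ_[p]) • padicCoeffIntegers.toField S a := by
  apply Subtype.ext
  change ((padicIntToCoeffIntegers S c : padicCoeffIntegers S) : PadicAlgCl p) * (a : PadicAlgCl p) =
    (((c : ℚ_[p]) • padicCoeffIntegers.toField S a : padicCoeffField S) : PadicAlgCl p)
  rw [IntermediateField.coe_smul, Algebra.smul_def, coe_padicIntToCoeffIntegers]
  rfl

/-- `toField : 𝒪 → K` is injective (it is the identity on `ℚ̄_p`). [cite: EmertonPollackWeston2006, §3.1 (p. 17) (plumbing)] -/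
theorem toField_injective : Function.Injective (padicCoeffIntegers.toField S) := by
  intro a b h
  apply Subtype.ext
  exact congrArg (fun z : padicCoeffField S => (z : PadicAlgCl p)) h

/-- **Extension of `ℤ_p`-linear maps from `𝒪` to `ℚ_p`-linear maps on `K = ℚ_p(S)`** (`K = 𝒪[1/p]`): a `ℤ_p`-linear additive `A : 𝒪 → V` into a
`ℚ_p`-vector space extends to a `ℚ_p`-linear `Â : K → V` with `Â|_𝒪 = A` (`Â x := p^{-a} A(p^a x)`). [cite: EmertonPollackWeston2006, §3.1 (p. 17)] -/
theorem exists_linearMap_extend {V : Type*} [AddCommGroup V] [Module ℚ_[p] V] (A : padicCoeffIntegers S →+ V)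
    (hA : ∀ (c : ℤ_[p]) (a : padicCoeffIntegers S), A (padicIntToCoeffIntegers S c * a) = (c : ℚ_[p]) • A a) :
    ∃ Â : padicCoeffField S →ₗ[ℚ_[p]] V, ∀ a : padicCoeffIntegers S, Â (padicCoeffIntegers.toField S a) = A a := by
  have hp0 : (p : ℚ_[p]) ≠ 0 := Nat.cast_ne_zero.mpr (Fact.out : p.Prime).ne_zero
  -- `ι₀(p^k) * ⟨p^a x⟩ = ⟨p^(k+a) x⟩` in `𝒪`
  have hmul : ∀ (x : padicCoeffField S) (a k : ℕ)
      (ha : (((p : ℚ_[p]) ^ a • x : padicCoeffField S) : PadicAlgCl p) ∈ padicCoeffIntegers S)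
      (hk : (((p : ℚ_[p]) ^ (k + a) • x : padicCoeffField S) : PadicAlgCl p) ∈ padicCoeffIntegers S),
      padicIntToCoeffIntegers S ((p : ℤ_[p]) ^ k) * (⟨_, ha⟩ : padicCoeffIntegers S) = ⟨_, hk⟩ := by
    intro x a k ha hk
    apply toField_injective S
    rw [toField_padicIntToCoeffIntegers_mul, coe_toField_mk_pow_smul, coe_toField_mk_pow_smul, smul_smul, PadicInt.coe_pow,
      PadicInt.coe_natCast, pow_add]
  -- the value `p^{-a} A(p^a x)` does not depend on the witness `a`
  have key : ∀ (x : padicCoeffField S) (a b : ℕ)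
      (ha : (((p : ℚ_[p]) ^ a • x : padicCoeffField S) : PadicAlgCl p) ∈ padicCoeffIntegers S)
      (hb : (((p : ℚ_[p]) ^ b • x : padicCoeffField S) : PadicAlgCl p) ∈ padicCoeffIntegers S),
      ((p : ℚ_[p]) ^ a)⁻¹ • A ⟨_, ha⟩ = ((p : ℚ_[p]) ^ b)⁻¹ • A ⟨_, hb⟩ := by
    intro x a b ha hb
    have hab : (((p : ℚ_[p]) ^ (b + a) • x : padicCoeffField S) : PadicAlgCl p) ∈ padicCoeffIntegers S := by
      rw [pow_add, ← smul_smul, IntermediateField.coe_smul, Algebra.smul_def, map_pow, map_natCast]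
      exact mul_mem (pow_mem (natCast_mem _ p) _) ha
    have hba : (((p : ℚ_[p]) ^ (a + b) • x : padicCoeffField S) : PadicAlgCl p) ∈ padicCoeffIntegers S := by
      rw [add_comm]; exact hab
    have h1 : ((p : ℚ_[p]) ^ b) • A ⟨_, ha⟩ = A ⟨_, hab⟩ := by
      rw [← hmul x a b ha hab, hA, PadicInt.coe_pow, PadicInt.coe_natCast]
    have h2 : ((p : ℚ_[p]) ^ a) • A ⟨_, hb⟩ = A ⟨_, hba⟩ := by
      rw [← hmul x b a hb hba, hA, PadicInt.coe_pow, PadicInt.coe_natCast]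
    have h3 : (A ⟨_, hab⟩ : V) = A ⟨_, hba⟩ := by
      congr 2; rw [add_comm]
    rw [← inv_smul_smul₀ (pow_ne_zero b hp0) (A ⟨_, ha⟩), h1, h3, ← h2, smul_smul, smul_smul]
    congr 1
    field_simp
  choose wit hwit using exists_pow_smul_mem_padicCoeffIntegers S
  -- any witness computes the same value
  have hval : ∀ (x : padicCoeffField S) (b : ℕ)
      (hb : (((p : ℚ_[p]) ^ b • x : padicCoeffField S) : PadicAlgCl p) ∈ padicCoeffIntegers S),
      ((p : ℚ_[p]) ^ wit x)⁻¹ • A ⟨_, hwit x⟩ = ((p : ℚ_[p]) ^ b)⁻¹ • A ⟨_, hb⟩ :=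
    fun x b hb => key x (wit x) b (hwit x) hb
  -- witnesses are stable under enlarging
  have hmono : ∀ (x : padicCoeffField S) (k : ℕ),
      (((p : ℚ_[p]) ^ (k + wit x) • x : padicCoeffField S) : PadicAlgCl p) ∈ padicCoeffIntegers S := by
    intro x k
    rw [pow_add, ← smul_smul, IntermediateField.coe_smul, Algebra.smul_def, map_pow, map_natCast]
    exact mul_mem (pow_mem (natCast_mem _ p) _) (hwit x)
  refine ⟨{ toFun := fun x => ((p : ℚ_[p]) ^ wit x)⁻¹ • A ⟨_, hwit x⟩, map_add' := ?_, map_smul' := ?_ }, ?_⟩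
  · intro x y
    have hx := hmono x (wit y)
    have hy : (((p : ℚ_[p]) ^ (wit y + wit x) • y : padicCoeffField S) : PadicAlgCl p) ∈ padicCoeffIntegers S := by
      rw [add_comm]; exact hmono y (wit x)
    have hxy : (((p : ℚ_[p]) ^ (wit y + wit x) • (x + y) : padicCoeffField S) : PadicAlgCl p) ∈ padicCoeffIntegers S := by
      rw [smul_add, IntermediateField.coe_add]
      exact add_mem hx hy
    have hsum : (⟨_, hxy⟩ : padicCoeffIntegers S) = ⟨_, hx⟩ + ⟨_, hy⟩ := by
      apply Subtype.ext
      change (((p : ℚ_[p]) ^ (wit y + wit x) • (x + y) : padicCoeffField S) : PadicAlgCl p) = _ + _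
      rw [smul_add, IntermediateField.coe_add]
    change ((p : ℚ_[p]) ^ wit (x + y))⁻¹ • A ⟨_, hwit (x + y)⟩ =
      ((p : ℚ_[p]) ^ wit x)⁻¹ • A ⟨_, hwit x⟩ + ((p : ℚ_[p]) ^ wit y)⁻¹ • A ⟨_, hwit y⟩
    rw [hval (x + y) _ hxy, hval x _ hx, hval y _ hy, ← smul_add, ← map_add, hsum]
  · intro c x
    change ((p : ℚ_[p]) ^ wit (c • x))⁻¹ • A ⟨_, hwit (c • x)⟩ = c • ((p : ℚ_[p]) ^ wit x)⁻¹ • A ⟨_, hwit x⟩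
    -- `p^k c ∈ ℤ_p` for `k` large
    obtain ⟨k, hk⟩ : ∃ k : ℕ, ‖(p : ℚ_[p]) ^ k * c‖ ≤ 1 := by
      have hp1 : (1 : ℝ) < p := by exact_mod_cast (Fact.out : p.Prime).one_lt
      have hpr : (0 : ℝ) < p := lt_trans zero_lt_one hp1
      obtain ⟨k, hk⟩ := pow_unbounded_of_one_lt ‖c‖ hp1
      refine ⟨k, ?_⟩
      rw [norm_mul, norm_pow, Padic.norm_p, inv_pow, inv_mul_le_iff₀ (pow_pos hpr k), mul_one]
      exact hk.le
    set c₀ : ℤ_[p] := ⟨(p : ℚ_[p]) ^ k * c, hk⟩ with hc₀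
    have hcc₀ : (c₀ : ℚ_[p]) = (p : ℚ_[p]) ^ k * c := rfl
    -- witness `k + wit x` for `c • x`
    have hcx : (((p : ℚ_[p]) ^ (k + wit x) • (c • x) : padicCoeffField S) : PadicAlgCl p) ∈ padicCoeffIntegers S := by
      have : ((p : ℚ_[p]) ^ (k + wit x) • (c • x) : padicCoeffField S) = (c₀ : ℚ_[p]) • ((p : ℚ_[p]) ^ wit x • x) := by
        rw [smul_smul, smul_smul, hcc₀]; ring_nf
      rw [this, ← coe_toField_mk_pow_smul S x (wit x) (hwit x), ← toField_padicIntToCoeffIntegers_mul]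
      exact (padicIntToCoeffIntegers S c₀ * ⟨_, hwit x⟩).2
    have hel : (⟨_, hcx⟩ : padicCoeffIntegers S) = padicIntToCoeffIntegers S c₀ * ⟨_, hwit x⟩ := by
      apply toField_injective S
      rw [toField_padicIntToCoeffIntegers_mul, coe_toField_mk_pow_smul, coe_toField_mk_pow_smul, smul_smul, smul_smul, hcc₀]
      ring_nf
    rw [hval (c • x) _ hcx, hel, hA, smul_smul, smul_smul, hcc₀]
    congr 1
    field_simp
    ring
  · intro a
    change ((p : ℚ_[p]) ^ wit (padicCoeffIntegers.toField S a))⁻¹ • A ⟨_, hwit _⟩ = A a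
    have h0 : (((p : ℚ_[p]) ^ 0 • padicCoeffIntegers.toField S a : padicCoeffField S) : PadicAlgCl p) ∈ padicCoeffIntegers S := by
      rw [pow_zero, one_smul]; exact a.2
    have ha : (⟨_, h0⟩ : padicCoeffIntegers S) = a := by
      apply toField_injective S
      rw [coe_toField_mk_pow_smul, pow_zero, one_smul]
    rw [hval _ 0 h0, ha, pow_zero, inv_one, one_smul]

/-- **Uniqueness of the extension**: two `ℚ_p`-linear maps on `K` agreeing on `𝒪` are equal. [cite: EmertonPollackWeston2006, §3.1 (p. 17)] -/
theorem linearMap_ext_of_padicCoeffIntegers {V : Type*} [AddCommGroup V] [Module ℚ_[p] V] (f g : padicCoeffField S →ₗ[ℚ_[p]] V)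
    (h : ∀ a : padicCoeffIntegers S, f (padicCoeffIntegers.toField S a) = g (padicCoeffIntegers.toField S a)) : f = g := by
  have hp0 : (p : ℚ_[p]) ≠ 0 := Nat.cast_ne_zero.mpr (Fact.out : p.Prime).ne_zero
  apply LinearMap.ext
  intro x
  obtain ⟨a, ha⟩ := exists_pow_smul_mem_padicCoeffIntegers S x
  have hx : x = ((p : ℚ_[p]) ^ a)⁻¹ • padicCoeffIntegers.toField S ⟨_, ha⟩ := by
    rw [coe_toField_mk_pow_smul, smul_smul, inv_mul_cancel₀ (pow_ne_zero _ hp0), one_smul]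
  rw [hx, map_smul, map_smul, h]

end Padic

end Summit.BirchSwinnertonDyer.BirchSwinnertonDyer.Theorems.ThetaTransport.StationR

end
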